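import Mathlib
import HarnessLib
import Summits.HubbardSuperconductivity.HubbardSuperconductivity.Theorems.WeakCouplingBCSDefsKlCertB1gWinATRecord
import Summits.HubbardSuperconductivity.HubbardSuperconductivity.Theorems.WeakCouplingBCSDefsKlCertB1gWinBTRecord
import Summits.HubbardSuperconductivity.HubbardSuperconductivity.Theorems.WeakCouplingBCSDefsKlCertB1gWinCTRecord
import Summits.HubbardSuperconductivity.HubbardSuperconductivity.Theorems.WeakCouplingBCSKlCertDopingSubwindows

/-!
# Route `WeakCouplingBCS` — support item `WcbcsKohnLuttingerB1g` (stmt-HubbardSuperconductivity-0158):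
# the TWO-SIDED Kohn–Luttinger coupling on the doping window of record `δ ∈ [0.10, 0.20]` (form (A)) and the EXPLICIT onset constant

Form (A) = theorem modulo the named, referee-replayable enclosures.  The two-sided window records `klCertB1gWin{A,B,C}T` (seat
hubbard-kl-cert-3 g2; margin-2's 44 boxes on `μ ∈ [-0.42749, -0.1775]` re-run with the `B1g` Temple/far rows) certify, modulo their
hypotheses `EnclosuresB1gT`, on each sub-window a two-sided enclosure of the `B1g` bottom (`…T_two_sided`) and `B1g` selection
(`…T_window_U`).  This file reads them in the CONSUMER's currency (`μ(δ) = chemicalPotentialOfDensity ε₀ (1 - δ)`, the unconditional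
`muOfDoping_mem_window_d010_d020`):

* `klb1gt_formA_two_sided_subwindows` / `klb1gt_formA_two_sided_window` — `-K ≤ channelInf ε₀ μ 1 B1g ≤ -a` per sub-window
  (`[-0.42749,-0.3775]`: `a = 0.126`, `K = 0.271`; `[-0.3775,-0.2275]`: `0.144`, `0.435`; `[-0.2275,-0.1775]`: `0.228`, `0.52`) and
  uniformly (`a = 0.126`, `K = 0.52`) on `μ ∈ [-0.42749, -0.1775]`;
* `klb1gt_formA_two_sided_doping` — **for every `δ ∈ [0.10, 0.20]`: `0.126 ≤ -channelInf ε₀ μ(δ) 1 B1g ≤ 0.52`** (the Kohn–Luttinger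
  coupling `klCoefficientB1g(μ_δ)` of the onset leaf `H1TwoPointLimitKLOnsetD`, two-sided, uniformly on the window of record);
* `klb1gt_formA_two_sided_doping_table` — the same per δ-SUB-WINDOW (`…KlCertDopingSubwindows`): `δ ∈ [0.10, 0.120]`:
  `[0.228, 0.52]`; `δ ∈ [0.1225, 0.1805]`: `[0.144, 0.435]`; `δ ∈ [0.183, 0.20]`: `[0.126, 0.271]`;
* `klb1gt_formA_kappa_band` — hence the onset exponent `κ_KL(δ) = (2π)²/klCoefficientB1g(μ_δ) ∈ [(2π)²/0.52, (2π)²/0.126]`;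
* `klb1gt_formA_onsetScale_band` — the onset scale `β_KL(δ,U) = exp((2π)²/(klCoeff·U²))` two-sided between `exp((2π)²/(K U²))`
  and `exp((2π)²/(a U²))`;
* `klb1gt_formA_onset_explicit` — the onset leaf `H1TwoPointLimitKLOnsetD` implies control with an EXPLICIT scale: for every `η ∈ (0,1)`
  there is `U₀ > 0` with thermodynamic limits of the thermal two-point functions for all `δ ∈ [0.10,0.20]`, `0 < U ≤ U₀`,
  `0 < β ≤ exp((1-η)(2π)²/(0.52·U²))`; `klb1gt_formA_control_explicit` — the `η = 1/2` reading: control for `β ≤ exp(c/U²)` with the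
  explicit `c = (2π)²/(2·0.52)` (the constant left unquantified — `∃ c` by compactness — in `R2dH1.control_certWindow_of_onset_of_neg`);
* `klb1gt_formA_r2d_certificate_T` — from the SAME hypotheses, the R2d certificate half δ-form (selection with `γ = 437/16384` and
  attraction `≤ -0.126·U²`), so that a consumer may cite one hypothesis set for selection, attraction and the two-sided coupling.

References: S. Raghu, S. A. Kivelson, D. J. Scalapino, Phys. Rev. B 81 (2010) 224505, §II (7), (13), §III Fig. 2; M. Reed, B. Simon,
*Methods of Modern Mathematical Physics IV*, Thm. XIII.5.
-/

noncomputable section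

-- the tree's namespace `Summit.<Summit>.<Problem>.Theorems` repeats the summit name by design (D-0017)
set_option linter.dupNamespace false

namespace Summit.HubbardSuperconductivity.HubbardSuperconductivity.Theorems

open MeasureTheory Filter Topology Literature.MathematicalPhysics.QuantumLattice CwKLChiralWindow
open Literature.Probability.LatticeModels
open Summit.HubbardSuperconductivity.HubbardSuperconductivity.Theses.WeakCouplingBCS

/-! ### The two-sided enclosure on the μ-window -/

/-- **Two-sided enclosure of the `B1g` bottom per sub-window**, modulo the enclosures of the three two-sided records:
`μ ∈ [-0.42749, -0.3775]`: `-0.271 ≤ channelInf ε₀ μ 1 B1g ≤ -0.126`; `μ ∈ [-0.3775, -0.2275]`: `-0.435 ≤ · ≤ -0.144`;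
`μ ∈ [-0.2275, -0.1775]`: `-0.52 ≤ · ≤ -0.228`. [cite: ReedSimonIV1978, Thm. XIII.5] -/
theorem klb1gt_formA_two_sided_subwindows (hA : klCertB1gWinAT.EnclosuresB1gT) (hB : klCertB1gWinBT.EnclosuresB1gT)
    (hC : klCertB1gWinCT.EnclosuresB1gT) :
    (∀ μ ∈ Set.Icc (-0.42749 : ℝ) (-0.3775), -(0.271 : ℝ) ≤ channelInf (squareDispersion 1 0) μ 1 D4Irrep.B1g ∧
        channelInf (squareDispersion 1 0) μ 1 D4Irrep.B1g ≤ -(0.126 : ℝ)) ∧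
    (∀ μ ∈ Set.Icc (-0.3775 : ℝ) (-0.2275), -(0.435 : ℝ) ≤ channelInf (squareDispersion 1 0) μ 1 D4Irrep.B1g ∧
        channelInf (squareDispersion 1 0) μ 1 D4Irrep.B1g ≤ -(0.144 : ℝ)) ∧
    (∀ μ ∈ Set.Icc (-0.2275 : ℝ) (-0.1775), -(0.52 : ℝ) ≤ channelInf (squareDispersion 1 0) μ 1 D4Irrep.B1g ∧
        channelInf (squareDispersion 1 0) μ 1 D4Irrep.B1g ≤ -(0.228 : ℝ)) := by
  have wA := klCertB1gWinAT_two_sided hA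
  have wB := klCertB1gWinBT_two_sided hB
  have wC := klCertB1gWinCT_two_sided hC
  have eA1 : (((klCertB1gWinAT).mub : ℚ) : ℝ) = -0.42749 := by
    show ((((-42749 : ℚ) / 100000) : ℚ) : ℝ) = -0.42749
    push_cast; norm_num
  have eA2 : (((klCertB1gWinAT).mua : ℚ) : ℝ) = -0.3775 := by
    show ((((-151 : ℚ) / 400) : ℚ) : ℝ) = -0.3775
    push_cast; norm_num
  have eB1 : (((klCertB1gWinBT).mub : ℚ) : ℝ) = -0.3775 := by
    show ((((-151 : ℚ) / 400) : ℚ) : ℝ) = -0.3775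
    push_cast; norm_num
  have eB2 : (((klCertB1gWinBT).mua : ℚ) : ℝ) = -0.2275 := by
    show ((((-91 : ℚ) / 400) : ℚ) : ℝ) = -0.2275
    push_cast; norm_num
  have eC1 : (((klCertB1gWinCT).mub : ℚ) : ℝ) = -0.2275 := by
    show ((((-91 : ℚ) / 400) : ℚ) : ℝ) = -0.2275
    push_cast; norm_num
  have eC2 : (((klCertB1gWinCT).mua : ℚ) : ℝ) = -0.1775 := by
    show ((((-71 : ℚ) / 400) : ℚ) : ℝ) = -0.1775
    push_cast; norm_num
  have kA : ((((271 : ℚ) / 1000) : ℚ) : ℝ) = (0.271 : ℝ) := by push_cast; norm_num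
  have aA : ((((63 : ℚ) / 500) : ℚ) : ℝ) = (0.126 : ℝ) := by push_cast; norm_num
  have kB : ((((87 : ℚ) / 200) : ℚ) : ℝ) = (0.435 : ℝ) := by push_cast; norm_num
  have aB : ((((18 : ℚ) / 125) : ℚ) : ℝ) = (0.144 : ℝ) := by push_cast; norm_num
  have kC : ((((13 : ℚ) / 25) : ℚ) : ℝ) = (0.52 : ℝ) := by push_cast; norm_num
  have aC : ((((57 : ℚ) / 250) : ℚ) : ℝ) = (0.228 : ℝ) := by push_cast; norm_num
  rw [eA1, eA2, kA, aA] at wA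
  rw [eB1, eB2, kB, aB] at wB
  rw [eC1, eC2, kC, aC] at wC
  exact ⟨wA, wB, wC⟩

/-- **Two-sided enclosure of the `B1g` bottom uniformly on the μ-window `[-0.42749, -0.1775]`** (the weakest sub-window constants):
`-0.52 ≤ channelInf ε₀ μ 1 B1g ≤ -0.126`. [cite: ReedSimonIV1978, Thm. XIII.5] -/
theorem klb1gt_formA_two_sided_window (hA : klCertB1gWinAT.EnclosuresB1gT) (hB : klCertB1gWinBT.EnclosuresB1gT)
    (hC : klCertB1gWinCT.EnclosuresB1gT) :
    ∀ μ ∈ Set.Icc (-0.42749 : ℝ) (-0.1775), -(0.52 : ℝ) ≤ channelInf (squareDispersion 1 0) μ 1 D4Irrep.B1g ∧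
      channelInf (squareDispersion 1 0) μ 1 D4Irrep.B1g ≤ -(0.126 : ℝ) := by
  obtain ⟨wA, wB, wC⟩ := klb1gt_formA_two_sided_subwindows hA hB hC
  intro μ hμ
  by_cases h1 : μ ≤ -0.3775
  · obtain ⟨l, u⟩ := wA μ ⟨hμ.1, h1⟩
    exact ⟨by linarith, by linarith⟩
  · by_cases h2 : μ ≤ -0.2275
    · obtain ⟨l, u⟩ := wB μ ⟨by linarith, h2⟩
      exact ⟨by linarith, by linarith⟩
    · obtain ⟨l, u⟩ := wC μ ⟨by linarith, hμ.2⟩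
      exact ⟨by linarith, by linarith⟩

/-! ### The δ-form and the onset exponent -/

/-- **The Kohn–Luttinger coupling, two-sided, on the doping window of record**: for every `δ ∈ [0.10, 0.20]`,
`0.126 ≤ -channelInf ε₀ μ(δ) 1 B1g ≤ 0.52` (`μ(δ) = chemicalPotentialOfDensity ε₀ (1-δ)`; the onset leaf's `klCoefficientB1g(μ_δ)`).
[cite: RaghuKivelsonScalapino2010, §III Fig. 2] -/
theorem klb1gt_formA_two_sided_doping (hA : klCertB1gWinAT.EnclosuresB1gT) (hB : klCertB1gWinBT.EnclosuresB1gT)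
    (hC : klCertB1gWinCT.EnclosuresB1gT) :
    ∀ δ ∈ Set.Icc (0.10 : ℝ) 0.20,
      (0.126 : ℝ) ≤ -channelInf (squareDispersion 1 0) (chemicalPotentialOfDensity (squareDispersion 1 0) (1 - δ)) 1 D4Irrep.B1g ∧
      -channelInf (squareDispersion 1 0) (chemicalPotentialOfDensity (squareDispersion 1 0) (1 - δ)) 1 D4Irrep.B1g ≤ (0.52 : ℝ) := by
  intro δ hδ
  obtain ⟨l, u⟩ := klb1gt_formA_two_sided_window hA hB hC _ (muOfDoping_mem_window_d010_d020 δ hδ)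
  exact ⟨by linarith, by linarith⟩

/-- **The Kohn–Luttinger coupling, two-sided, per δ-sub-window** (the μ-sub-windows of the three records read through the
certified doping brackets of their ends, `…KlCertDopingSubwindows`): `δ ∈ [0.10, 0.120]`: `0.228 ≤ -channelInf ε₀ μ(δ) 1 B1g ≤ 0.52`;
`δ ∈ [0.1225, 0.1805]`: `0.144 ≤ · ≤ 0.435`; `δ ∈ [0.183, 0.20]`: `0.126 ≤ · ≤ 0.271` (the gaps around `δ(-0.2275) ≈ 0.1211`,
`δ(-0.3775) ≈ 0.1817` are covered by `klb1gt_formA_two_sided_doping`). [cite: RaghuKivelsonScalapino2010, §III Fig. 2] -/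
theorem klb1gt_formA_two_sided_doping_table (hA : klCertB1gWinAT.EnclosuresB1gT) (hB : klCertB1gWinBT.EnclosuresB1gT)
    (hC : klCertB1gWinCT.EnclosuresB1gT) :
    (∀ δ ∈ Set.Icc (0.10 : ℝ) 0.120,
      (0.228 : ℝ) ≤ -channelInf (squareDispersion 1 0) (chemicalPotentialOfDensity (squareDispersion 1 0) (1 - δ)) 1 D4Irrep.B1g ∧
      -channelInf (squareDispersion 1 0) (chemicalPotentialOfDensity (squareDispersion 1 0) (1 - δ)) 1 D4Irrep.B1g ≤ (0.52 : ℝ)) ∧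
    (∀ δ ∈ Set.Icc (0.1225 : ℝ) 0.1805,
      (0.144 : ℝ) ≤ -channelInf (squareDispersion 1 0) (chemicalPotentialOfDensity (squareDispersion 1 0) (1 - δ)) 1 D4Irrep.B1g ∧
      -channelInf (squareDispersion 1 0) (chemicalPotentialOfDensity (squareDispersion 1 0) (1 - δ)) 1 D4Irrep.B1g ≤ (0.435 : ℝ)) ∧
    (∀ δ ∈ Set.Icc (0.183 : ℝ) 0.20,
      (0.126 : ℝ) ≤ -channelInf (squareDispersion 1 0) (chemicalPotentialOfDensity (squareDispersion 1 0) (1 - δ)) 1 D4Irrep.B1g ∧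
      -channelInf (squareDispersion 1 0) (chemicalPotentialOfDensity (squareDispersion 1 0) (1 - δ)) 1 D4Irrep.B1g ≤ (0.271 : ℝ)) := by
  obtain ⟨wA, wB, wC⟩ := klb1gt_formA_two_sided_subwindows hA hB hC
  refine ⟨fun δ hδ => ?_, fun δ hδ => ?_, fun δ hδ => ?_⟩
  · obtain ⟨l, u⟩ := wC _ (muOfDoping_mem_subwindow_d0100_d0120 δ hδ)
    exact ⟨by linarith, by linarith⟩
  · obtain ⟨l, u⟩ := wB _ (muOfDoping_mem_subwindow_d01225_d01805 δ hδ)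
    exact ⟨by linarith, by linarith⟩
  · obtain ⟨l, u⟩ := wA _ (muOfDoping_mem_subwindow_d0183_d0200 δ hδ)
    exact ⟨by linarith, by linarith⟩

/-- **The onset exponent band**: for every `δ ∈ [0.10, 0.20]`, `κ_KL(δ) = (2π)²/(-channelInf ε₀ μ(δ) 1 B1g)` lies in
`[(2π)²/0.52, (2π)²/0.126]`. [cite: RaghuKivelsonScalapino2010, §II (13)] -/
theorem klb1gt_formA_kappa_band (hA : klCertB1gWinAT.EnclosuresB1gT) (hB : klCertB1gWinBT.EnclosuresB1gT)
    (hC : klCertB1gWinCT.EnclosuresB1gT) :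
    ∀ δ ∈ Set.Icc (0.10 : ℝ) 0.20,
      (2 * Real.pi) ^ 2 / 0.52 ≤ (2 * Real.pi) ^ 2 /
          -channelInf (squareDispersion 1 0) (chemicalPotentialOfDensity (squareDispersion 1 0) (1 - δ)) 1 D4Irrep.B1g ∧
      (2 * Real.pi) ^ 2 / -channelInf (squareDispersion 1 0) (chemicalPotentialOfDensity (squareDispersion 1 0) (1 - δ)) 1 D4Irrep.B1g ≤
          (2 * Real.pi) ^ 2 / 0.126 := by
  intro δ hδ
  obtain ⟨l, u⟩ := klb1gt_formA_two_sided_doping hA hB hC δ hδ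
  have hpi : 0 < (2 * Real.pi) ^ 2 := by positivity
  set κ := -channelInf (squareDispersion 1 0) (chemicalPotentialOfDensity (squareDispersion 1 0) (1 - δ)) 1 D4Irrep.B1g
  have hκ : 0 < κ := by linarith
  exact ⟨div_le_div_of_nonneg_left hpi.le hκ u, div_le_div_of_nonneg_left hpi.le (by norm_num) l⟩

/-- **The Kohn–Luttinger onset scale, two-sided**: for every `δ ∈ [0.10, 0.20]` and every `U ≠ 0`, the onset inverse temperature
`β_KL(δ, U) = exp(κ_KL(δ)/U²) = exp((2π)²/(klCoefficientB1g(μ_δ)·U²))` of the leaf `H1TwoPointLimitKLOnsetD` satisfies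
`exp((2π)²/(0.52·U²)) ≤ β_KL(δ, U) ≤ exp((2π)²/(0.126·U²))`. [cite: RaghuKivelsonScalapino2010, §II (13)] -/
theorem klb1gt_formA_onsetScale_band (hA : klCertB1gWinAT.EnclosuresB1gT) (hB : klCertB1gWinBT.EnclosuresB1gT)
    (hC : klCertB1gWinCT.EnclosuresB1gT) :
    ∀ δ ∈ Set.Icc (0.10 : ℝ) 0.20, ∀ U : ℝ, U ≠ 0 →
      Real.exp ((2 * Real.pi) ^ 2 / (0.52 * U ^ 2)) ≤
          Real.exp ((2 * Real.pi) ^ 2 /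
            (-channelInf (squareDispersion 1 0) (chemicalPotentialOfDensity (squareDispersion 1 0) (1 - δ)) 1 D4Irrep.B1g * U ^ 2)) ∧
      Real.exp ((2 * Real.pi) ^ 2 /
            (-channelInf (squareDispersion 1 0) (chemicalPotentialOfDensity (squareDispersion 1 0) (1 - δ)) 1 D4Irrep.B1g * U ^ 2)) ≤
          Real.exp ((2 * Real.pi) ^ 2 / (0.126 * U ^ 2)) := by
  intro δ hδ U hU
  obtain ⟨l, u⟩ := klb1gt_formA_two_sided_doping hA hB hC δ hδ
  set κ := -channelInf (squareDispersion 1 0) (chemicalPotentialOfDensity (squareDispersion 1 0) (1 - δ)) 1 D4Irrep.B1g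
  have hκ : 0 < κ := by linarith
  have hU2 : 0 < U ^ 2 := by positivity
  have hpi : 0 ≤ (2 * Real.pi) ^ 2 := by positivity
  refine ⟨Real.exp_le_exp.2 ?_, Real.exp_le_exp.2 ?_⟩
  · exact div_le_div_of_nonneg_left hpi (by positivity) (by nlinarith)
  · exact div_le_div_of_nonneg_left hpi (by positivity) (by nlinarith)

/-- **The onset leaf with an EXPLICIT scale.** Modulo the enclosures of the three two-sided records, `H1TwoPointLimitKLOnsetD` implies: for
every `η ∈ (0,1)` there is `U₀ > 0` such that for all `δ ∈ [0.10, 0.20]`, `0 < U ≤ U₀` and `0 < β ≤ exp((1-η)·(2π)²/(0.52·U²))` the thermal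
two-point functions at `μ(δ)` have thermodynamic limits (`(2π)²/0.52 ≤ κ_KL(δ)` on the window). [cite: RaghuKivelsonScalapino2010, §II (13)] -/
theorem klb1gt_formA_onset_explicit (hA : klCertB1gWinAT.EnclosuresB1gT) (hB : klCertB1gWinBT.EnclosuresB1gT)
    (hC : klCertB1gWinCT.EnclosuresB1gT) (hon : H1TwoPointLimitKLOnsetD) :
    ∀ η : ℝ, 0 < η → η < 1 → ∃ U₀ : ℝ, 0 < U₀ ∧ ∀ δ ∈ Set.Icc (0.10 : ℝ) 0.20, ∀ U β : ℝ, 0 < U → U ≤ U₀ → 0 < β →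
      β ≤ Real.exp ((1 - η) * (2 * Real.pi) ^ 2 / (0.52 * U ^ 2)) →
      ∀ (x y : Site 2) (σ σ' : Fin 2), ∃ S : ℂ,
        Tendsto (fun L : ℕ => hubbardThermalTwoPoint β U
          (chemicalPotentialOfDensity (squareDispersion 1 0) (1 - δ)) L x y σ σ') atTop (𝓝 S) := by
  intro η hη hη1
  obtain ⟨U₀, hU₀, H⟩ := hon η hη hη1
  refine ⟨U₀, hU₀, ?_⟩
  intro δ hδ U β hU hUle hβ hβle x y σ σ'
  refine H δ hδ U β hU hUle hβ (hβle.trans (Real.exp_le_exp.2 ?_)) x y σ σ'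
  obtain ⟨l, u⟩ := klb1gt_formA_two_sided_doping hA hB hC δ hδ
  set κ := -channelInf (squareDispersion 1 0) (chemicalPotentialOfDensity (squareDispersion 1 0) (1 - δ)) 1 D4Irrep.B1g
  have hκ : 0 < κ := by linarith
  have hnum : 0 ≤ (1 - η) * (2 * Real.pi) ^ 2 := by
    have : 0 ≤ 1 - η := by linarith
    positivity
  have hU2 : 0 < U ^ 2 := by positivity
  exact div_le_div_of_nonneg_left hnum (by positivity) (by nlinarith)

/-- **Control on the certificate window with the explicit constant `c = (2π)²/(2·0.52)`** (the `η = 1/2` reading of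
`klb1gt_formA_onset_explicit`): modulo the enclosures, `H1TwoPointLimitKLOnsetD` implies `∃ U₀ > 0, ∀ δ ∈ [0.10,0.20], ∀ 0 < U ≤ U₀,
∀ 0 < β ≤ exp(c/U²)`, thermodynamic limits of the thermal two-point functions at `μ(δ)` — the shape of
`R2dH1.control_certWindow_of_onset_of_neg` with its compactness constant made a numeral. [cite: RaghuKivelsonScalapino2010, §II (13)] -/
theorem klb1gt_formA_control_explicit (hA : klCertB1gWinAT.EnclosuresB1gT) (hB : klCertB1gWinBT.EnclosuresB1gT)
    (hC : klCertB1gWinCT.EnclosuresB1gT) (hon : H1TwoPointLimitKLOnsetD) :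
    ∃ U₀ : ℝ, 0 < U₀ ∧ ∀ δ ∈ Set.Icc (0.10 : ℝ) 0.20, ∀ U β : ℝ, 0 < U → U ≤ U₀ → 0 < β →
      β ≤ Real.exp ((2 * Real.pi) ^ 2 / (2 * 0.52) / U ^ 2) →
      ∀ (x y : Site 2) (σ σ' : Fin 2), ∃ S : ℂ,
        Tendsto (fun L : ℕ => hubbardThermalTwoPoint β U
          (chemicalPotentialOfDensity (squareDispersion 1 0) (1 - δ)) L x y σ σ') atTop (𝓝 S) := by
  obtain ⟨U₀, hU₀, H⟩ := klb1gt_formA_onset_explicit hA hB hC hon (1 / 2) (by norm_num) (by norm_num)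
  refine ⟨U₀, hU₀, ?_⟩
  intro δ hδ U β hU hUle hβ hβle x y σ σ'
  refine H δ hδ U β hU hUle hβ (hβle.trans (le_of_eq ?_)) x y σ σ'
  congr 1
  have hU2 : U ^ 2 ≠ 0 := by positivity
  field_simp
  ring

/-! ### Selection and attraction from the same hypotheses -/

/-- **R2d certificate half, form (A), δ-form, from the two-sided records**: for every `δ ∈ [0.10, 0.20]`, (i) SELECTION — for every
`0 < U < 1` and `χ ≠ B1g`, `channelInf ε₀ μ(δ) U B1g + (437/16384) U² ≤ channelInf ε₀ μ(δ) U χ` (`437/16384` = the smallest of the three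
record margins); (ii) ATTRACTION — for every real `U`, `channelInf ε₀ μ(δ) U B1g ≤ -0.126·U²`. [cite: RaghuKivelsonScalapino2010, §III Fig. 2] -/
theorem klb1gt_formA_r2d_certificate_T (hA : klCertB1gWinAT.EnclosuresB1gT) (hB : klCertB1gWinBT.EnclosuresB1gT)
    (hC : klCertB1gWinCT.EnclosuresB1gT) :
    ∀ δ ∈ Set.Icc (0.10 : ℝ) 0.20,
      (∀ U ∈ Set.Ioo (0 : ℝ) 1, ∀ χ : D4Irrep, χ ≠ D4Irrep.B1g →
        channelInf (squareDispersion 1 0) (chemicalPotentialOfDensity (squareDispersion 1 0) (1 - δ)) U D4Irrep.B1g +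
            (437 / 16384 : ℝ) * U ^ 2 ≤
          channelInf (squareDispersion 1 0) (chemicalPotentialOfDensity (squareDispersion 1 0) (1 - δ)) U χ) ∧
      (∀ U : ℝ, channelInf (squareDispersion 1 0) (chemicalPotentialOfDensity (squareDispersion 1 0) (1 - δ)) U
          D4Irrep.B1g ≤ -(0.126 : ℝ) * U ^ 2) := by
  intro δ hδ
  have hμ := muOfDoping_mem_window_d010_d020 δ hδ
  set μ := chemicalPotentialOfDensity (squareDispersion 1 0) (1 - δ) with hμdef
  have hmo : μ ∈ Set.Ioo (-4 : ℝ) 0 := ⟨by linarith [hμ.1], by linarith [hμ.2]⟩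
  have sA := klCertB1gWinAT_window_U hA
  have sB := klCertB1gWinBT_window_U hB
  have sC := klCertB1gWinCT_window_U hC
  have eA1 : (((klCertB1gWinAT).mub : ℚ) : ℝ) = -0.42749 := by
    show ((((-42749 : ℚ) / 100000) : ℚ) : ℝ) = -0.42749
    push_cast; norm_num
  have eA2 : (((klCertB1gWinAT).mua : ℚ) : ℝ) = -0.3775 := by
    show ((((-151 : ℚ) / 400) : ℚ) : ℝ) = -0.3775
    push_cast; norm_num
  have eB1 : (((klCertB1gWinBT).mub : ℚ) : ℝ) = -0.3775 := by
    show ((((-151 : ℚ) / 400) : ℚ) : ℝ) = -0.3775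
    push_cast; norm_num
  have eB2 : (((klCertB1gWinBT).mua : ℚ) : ℝ) = -0.2275 := by
    show ((((-91 : ℚ) / 400) : ℚ) : ℝ) = -0.2275
    push_cast; norm_num
  have eC1 : (((klCertB1gWinCT).mub : ℚ) : ℝ) = -0.2275 := by
    show ((((-91 : ℚ) / 400) : ℚ) : ℝ) = -0.2275
    push_cast; norm_num
  have eC2 : (((klCertB1gWinCT).mua : ℚ) : ℝ) = -0.1775 := by
    show ((((-71 : ℚ) / 400) : ℚ) : ℝ) = -0.1775
    push_cast; norm_num
  have gA : (((klCertB1gWinAT).gamma : ℚ) : ℝ) = ((((30209 : ℚ) / 1048576) : ℚ) : ℝ) := by rfl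
  have gB : (((klCertB1gWinBT).gamma : ℚ) : ℝ) = ((((437 : ℚ) / 16384) : ℚ) : ℝ) := by rfl
  have gC : (((klCertB1gWinCT).gamma : ℚ) : ℝ) = ((((32921 : ℚ) / 1048576) : ℚ) : ℝ) := by rfl
  rw [eA1, eA2, gA] at sA
  rw [eB1, eB2, gB] at sB
  rw [eC1, eC2, gC] at sC
  push_cast at sA sB sC
  refine ⟨fun U hU χ hχ => ?_, fun U => ?_⟩
  · have hU2 : 0 ≤ U ^ 2 := sq_nonneg U
    have hgA : (437 / 16384 : ℝ) * U ^ 2 ≤ ((30209 : ℝ) / 1048576) * U ^ 2 :=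
      mul_le_mul_of_nonneg_right (by norm_num) hU2
    have hgB : (437 / 16384 : ℝ) * U ^ 2 ≤ ((437 : ℝ) / 16384) * U ^ 2 :=
      mul_le_mul_of_nonneg_right (by norm_num) hU2
    have hgC : (437 / 16384 : ℝ) * U ^ 2 ≤ ((32921 : ℝ) / 1048576) * U ^ 2 :=
      mul_le_mul_of_nonneg_right (by norm_num) hU2
    by_cases h1 : μ ≤ -0.3775
    · have h := sA μ ⟨hμ.1, h1⟩ U hU χ hχ
      linarith [h, hgA]
    · by_cases h2 : μ ≤ -0.2275
      · have h := sB μ ⟨by linarith, h2⟩ U hU χ hχ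
        linarith [h, hgB]
      · have h := sC μ ⟨by linarith, hμ.2⟩ U hU χ hχ
        linarith [h, hgC]
  · have hfin : IsFiniteMeasure (fermiCurveMeasure (squareDispersion 1 0) μ) :=
      stub_klFiniteMeasure stub_klGradient stub_klHausdorffFinite μ hmo
    have hinv := stub_klD4Invariant stub_klGradient μ hmo
    have hhom : channelInf (squareDispersion 1 0) μ U D4Irrep.B1g =
        U ^ 2 * channelInf (squareDispersion 1 0) μ 1 D4Irrep.B1g :=
      klhs_channelInf_sq stub_klKernelHS hmo U D4Irrep.B1g
        (fun ψ hψ => (stub_klMeanZero _ _ hfin hinv D4Irrep.B1g ψ (by decide) hψ).2)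
    have h1 := (klb1gt_formA_two_sided_window hA hB hC μ hμ).2
    rw [hhom]
    nlinarith [sq_nonneg U]

end Summit.HubbardSuperconductivity.HubbardSuperconductivity.Theorems

end
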